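import Summits.QuantumFields.YangMills.Theses.SquareRootCeilings
import Summits.QuantumFields.YangMills.Theses.AntiScreeningCeilings
import Summits.QuantumFields.YangMills.Theorems.TypicalExteriorCeilingsFactorialCalibration

/-!
# Routes `SquareRootCeilings` ∕ `AntiScreeningCeilings` — the shared support `FactorialCalibrationC`
# (stmt-QuantumFields-26673) BY NAME

Both route files restate the support `TypicalExteriorCeilings.FactorialCalibration` (stmt-QuantumFields-25894) by name
(`FactorialCalibrationC := TypicalExteriorCeilings.FactorialCalibration`); it is proved in
`Theorems/TypicalExteriorCeilingsFactorialCalibration.lean` (`factorialCalibration_proof`: the factorial-tolerant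
sub-onset ceilings → `OnsetFloors` → `OnsetVanishes` → `HypercubicOSDataFromInfiniteVolume`, by the calibration of
`OnsetCalibration.assembly_proof` run with the per-order infinite-volume engine).  This file records the two one-line
closures.

HONEST LABEL: glue only; the leaves of both routes stay conditional on their open cruxes (`SqrtDomination`,
`SubOnsetTwoPointCeilings` ∕ the anti-screening ceilings, and the NT residual `OnsetFloors`).  No summit, no mass gap
and no Clay statement is proved; rung R2a RECORD label only.

References: K. Osterwalder, R. Schrader, CMP 42 (1975) 281–305 [OsterwalderSchrader1975] (§2, E0′).
-/

namespace Summit.QuantumFields.YangMills.Theorems.SquareRootCeilings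

/-- **Support `FactorialCalibrationC` of route `SquareRootCeilings`** (stmt-QuantumFields-26673), by name from
`TypicalExteriorCeilings.factorialCalibration_proof`. -/
theorem factorialCalibrationC_proof : Summit.QuantumFields.YangMills.Theses.SquareRootCeilings.FactorialCalibrationC :=
  Summit.QuantumFields.YangMills.Theorems.TypicalExteriorCeilings.factorialCalibration_proof

end Summit.QuantumFields.YangMills.Theorems.SquareRootCeilings

namespace Summit.QuantumFields.YangMills.Theorems.AntiScreeningCeilings

/-- **Support `FactorialCalibrationC` of route `AntiScreeningCeilings`** (stmt-QuantumFields-26673), by name from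
`TypicalExteriorCeilings.factorialCalibration_proof`. -/
theorem factorialCalibrationC_proof :
    Summit.QuantumFields.YangMills.Theses.AntiScreeningCeilings.FactorialCalibrationC :=
  Summit.QuantumFields.YangMills.Theorems.TypicalExteriorCeilings.factorialCalibration_proof

end Summit.QuantumFields.YangMills.Theorems.AntiScreeningCeilings
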